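import Mathlib
import Summits.Ventures.PercRepro.PuncturedLYMUnif45Table
import Summits.Ventures.PercRepro.PuncturedLYMUnif45Cols1

/-!
# PercRepro — (SP) FOR ANY NUMBER OF PAIRWISE DISJOINT `4`-SETS AT LEVEL `5`: THE COLUMN IDENTITIES, ASSEMBLED
(p10, gen 40)

`col_check`: the column identity of every free column class with `Σ v d_v ≤ 6`, by `interval_cases` over the class counts.  Nothing here asserts (SP).
-/

namespace PercRepro.PuncturedLYM.Split.TypeLift.Unif45

/-- The column identity of every free column class, in one statement. -/
theorem col_check (n k : ℚ) (hQ : Qp n k ≠ 0) (hP : Pp n k ≠ 0) (d1 d2 d3 : ℕ)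
    (h : d1 + 2 * d2 + 3 * d3 ≤ 6) :
    1 * (d1 : ℚ) * raw n k (d1 - 1) d2 d3 0 + 2 * (d2 : ℚ) * raw n k (d1 + 1) (d2 - 1) d3 1 + 3 * (d3 : ℚ) * raw n k d1 (d2 + 1) (d3 - 1) 2 +
      ((6 : ℚ) - d1 - 2 * d2 - 3 * d3) * raw n k d1 d2 d3 4 = 1 := by
  have hb1 : d1 ≤ 6 := by omega
  have hb2 : d2 ≤ 3 := by omega
  have hb3 : d3 ≤ 2 := by omega
  interval_cases d1 <;> interval_cases d2 <;> interval_cases d3 <;> push_cast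
  · linear_combination col_000 n k hQ hP
  · linear_combination col_001 n k hQ hP
  · linear_combination col_002 n k hQ hP
  · linear_combination col_010 n k hQ hP
  · linear_combination col_011 n k hQ hP
  · omega
  · linear_combination col_020 n k hQ hP
  · omega
  · omega
  · linear_combination col_030 n k hQ hP
  · omega
  · omega
  · linear_combination col_100 n k hQ hP
  · linear_combination col_101 n k hQ hP
  · omega
  · linear_combination col_110 n k hQ hP
  · linear_combination col_111 n k hQ hP
  · omega
  · linear_combination col_120 n k hQ hP
  · omega
  · omega
  · omega
  · omega
  · omega
  · linear_combination col_200 n k hQ hP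
  · linear_combination col_201 n k hQ hP
  · omega
  · linear_combination col_210 n k hQ hP
  · omega
  · omega
  · linear_combination col_220 n k hQ hP
  · omega
  · omega
  · omega
  · omega
  · omega
  · linear_combination col_300 n k hQ hP
  · linear_combination col_301 n k hQ hP
  · omega
  · linear_combination col_310 n k hQ hP
  · omega
  · omega
  · omega
  · omega
  · omega
  · omega
  · omega
  · omega
  · linear_combination col_400 n k hQ hP
  · omega
  · omega
  · linear_combination col_410 n k hQ hP
  · omega
  · omega
  · omega
  · omega
  · omega
  · omega
  · omega
  · omega
  · linear_combination col_500 n k hQ hP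
  · omega
  · omega
  · omega
  · omega
  · omega
  · omega
  · omega
  · omega
  · omega
  · omega
  · omega
  · linear_combination col_600 n k hQ hP
  · omega
  · omega
  · omega
  · omega
  · omega
  · omega
  · omega
  · omega
  · omega
  · omega
  · omega

end PercRepro.PuncturedLYM.Split.TypeLift.Unif45
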